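import Summits.QuantumFields.YangMills.Theorems.BalabanUVNodesN15PerCubeGreenTwoGridEntryZeroReadoutRateWeight
import Summits.QuantumFields.YangMills.Theorems.BalabanUVNodesN15BackgroundEntry2ByParts
import HarnessLib

/-!
# N15 = NE2, road (c) — PROGRAMME (PC), TOWARDS ENTRY 3 OF (3.42) (`Δ_U G′`) AT TWO SPACINGS WITHOUT JETS: the exact equation `(Δ_{R_U} + P)∘G′ = 1` turns the two-grid η-defect of
# `Δ_{R_U}G′` into `−(P′∘𝔇(G′,G) + 𝔇(P′,P)∘G)` — the algebra, and the block-majorant composition that reduces the entry-3 row to the entry-0 row (n15-c∕374∕375), the decay of `G`,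
# a bound on the summand `P′`, and ONE located two-grid row `𝔇(P′,P)` of the covariant averaging summand (dag-n15-c g34, n15-c∕376)

Cell `pub-ymgap`, seat `pub-ymgap-dag-n15-c` (generation g34; R134 (a) seat, strategy s1 «first missing estimate»; HUMAN RULING D-0062; chair R424 venue).
`bears_on: R4∕N15 · K3⁸ SpineGivenEndpointR13SepCoPHV (stmt-QuantumFields-27366)`; filed `--kind proof --supports stmt-QuantumFields-27366 --as helper` — COUNT-NEUTRAL.
Theorems only (GENERIC: abstract real vector spaces, [B6] block geometries, `B11SectG` block norms), 0 `def`, 0 `sorry`.  Imports BY NAME n15-c∕375 (for the chain's context only) and this seat's g8 `…BackgroundEntry2ByParts` (`idef_id_id_zero`); the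
statements use `T4EtaRateDefect.idef` ∕ `idef_comp` ∕ `idef_sub`, `B11SectG.HasMaj` ∕ `hasMaj_comp_exp` ∕ `HasMaj.add` ∕ `HasMaj.neg`, `B6RandomWalk.Triangle254`, `RowSum`).  Nothing in the
tree is modified, no landed name re-declared.

WHY (HOME memo `EVIDENCE-N15C-G34-HOLDER-NATIVE.md` §4 (J); `PCE-DESIGN-g31.md` §6).  [B9] Thm 3.1 (3.42) has FOUR sup entries for the scalar covariant Green's function `G′(U)`:
`G′`, `∇_UG′`, `G′∇*_U`, `Δ_UG′`; the (PC-E)∕(PC-E-H) chain delivers the two-grid η-defect of entry 0 (n15-c∕374: on the printed per-cube class, uniformly in the fine spacing; n15-c∕375: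
in the node's readout currency).  Entries 1–2 need the JET editions of the glue.  Entry 3 does NOT: dag-n15-w3's knit (`uN_scGlued_spec`) proves the EXACT identity
`(Δ_{R_U} + P)∘G′ = 1` on each grid (`P = a·Q′_T(U)ᵀQ′_T(U)` Bałaban's averaging summand, n15-c `scP`), so `Δ_{R_U}G′ = 1 − PG′` and, the transports of input and output being
the same `τ`, `𝔇_τ(Δ′G′, ΔG) = 𝔇_τ(1,1) − 𝔇_τ(P′G′, PG) = −(P′∘𝔇_τ(G′,G) + 𝔇_τ(P′,P)∘G)` (Leibniz rule `idef_comp`).  THIS FILE is that reduction, generic: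
* §1 ★★ `idef_entryThree_eq` (the identity above from the two inverse equations; `𝔇_τ(1,1) = 0` is this seat's g8 `BackgroundLayer.idef_id_id_zero`).
* §2 ★★★ `hasMaj_idef_entryThree` — on a [B6] block geometry with the triangle inequality, nonnegative distance and a row sum at margin `σ`: from block majorants `P′ ≤ a_Pe^{−ρ₁d}`,
  `G ≤ Be^{−ρ₂d}`, `𝔇_τ(G′,G) ≤ εe^{−ρd}` (ENTRY 0) and `𝔇_τ(P′,P) ≤ o_Pe^{−ρd}` (the located row), the ENTRY-3 defect has majorant `(κ′a_Pε + κo_PB)·c·e^{−ρ₀d}` for every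
  `ρ₀ ≥ 0` with `ρ₀ + σ ≤ min(ρ, ρ₁, ρ₂)` (`σ ≥ 0`) — so entry 3's rate is entry 0's rate `ε` plus `o_P`.
Instantiation at the chain's objects (the glued Green's functions of n15-c∕339–374 with the produced cube gauges, `P = scP`, `τ = τ_S`) needs, besides n15-c∕374's row: the decay of the
coarse glued Green's function and the inverse identities WITH THE SAME produced gauges (dag-n15-w3 52 ∕ `uN_scGlued_spec`, to be carried through n15-c∕340's letter production), a block
bound on `scP′` for a unitary fine field (`hasMaj_csavg` ∕ `hasMaj_csavg_transpose` with the row letter `|ι|` of `rows_cvaStair_cvT_le`), and the ONE new estimate `𝔇_{τ_S}(scP′, scP) = O(η)`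
(block-diagonal; per block in the cube gauge: `τ_S = M_S∘P̂` with `‖S − 1‖ = O(ηp)` by the stair letters, and the flat Gram comparison of n15-c∕351∕352 `abs_gramDefect_le`) — LOCATED, not
typed here.

HONEST FRAMING ∕ LIMITS.  Linear algebra and block-norm bookkeeping; nothing of [B9] asserted ((3.42) p.397, (3.24)–(3.25) p.394 = SHAPES).  NE2⁺ NOT PRINTED ∕ NOT proved; N15 of record
untouched (DISCHARGED AS CONSUMED, p687738); K3⁸ OPEN; counts of record UNMOVED (typed 28∕28 · discharged 8∕27); one finite 𝕋⁴ at fixed ε per index — NOT infinite volume, NOT OS on ℝ⁴, NOT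
a mass gap, NOT Clay.  Restate-immune (no Theses import).
-/

set_option autoImplicit false

noncomputable section

open scoped BigOperators
open Finset

namespace Summit.QuantumFields.YangMills.BalabanUVNodes.N15.Gluing

open Literature.MathematicalPhysics.QuantumFieldTheory.Balaban1983to89
open Literature.MathematicalPhysics.QuantumFieldTheory.Balaban1983to89.B11SectG (BlockNorm HasMaj RowSum hasMaj_comp_exp)
open Literature.MathematicalPhysics.QuantumFieldTheory.Balaban1983to89.B6RandomWalk (Triangle254)
open Literature.MathematicalPhysics.QuantumFieldTheory.Balaban1983to89.T4EtaRateDefect (idef idef_comp idef_sub)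
open Summit.QuantumFields.YangMills.BalabanUVNodes.N15.BackgroundLayer (idef_id_id_zero)

/-! ## §1 Algebra: the entry-3 defect from the two inverse equations -/

section Algebra

variable {F₁ F₂ F₁' F₂' : Type} [AddCommGroup F₁] [Module ℝ F₁] [AddCommGroup F₂] [Module ℝ F₂] [AddCommGroup F₁'] [Module ℝ F₁'] [AddCommGroup F₂'] [Module ℝ F₂']

/-- ★★ **THE ENTRY-3 DEFECT FROM THE EXACT EQUATIONS**: if `(Δ′ + P′)∘G′ = 1` (fine) and `(Δ + P)∘G = 1` (coarse), then for input transport `τ₁ : F₁ → F₁′` and output transport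
`τ₂ : F₂ → F₂′`, `𝔇_{τ₁,τ₁}(Δ′∘G′, Δ∘G) = −(P′ ∘ 𝔇_{τ₁,τ₂}(G′,G) + 𝔇_{τ₂,τ₁}(P′,P) ∘ G)` (`Δ′G′ = 1 − P′G′`, `𝔇(1,1) = 0`, Leibniz).  In the application `Δ = Δ_{R_U}` (covariant
Laplacian in the `Ad`-species), `P = a·Q′_T(U)ᵀQ′_T(U)`, `G = G′(U)` the scalar covariant Green's function, `τ₁ = τ₂ = τ_S`. [cite: Balaban1985BackgroundPropagators, (3.24)–(3.25)
p.394, (3.42) p.397 (shapes)] -/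
theorem idef_entryThree_eq (τ₁ : F₁ →ₗ[ℝ] F₁') (τ₂ : F₂ →ₗ[ℝ] F₂') {G : F₁ →ₗ[ℝ] F₂} {Δ P : F₂ →ₗ[ℝ] F₁} {G' : F₁' →ₗ[ℝ] F₂'} {Δ' P' : F₂' →ₗ[ℝ] F₁'}
    (hinv' : (Δ' + P') ∘ₗ G' = LinearMap.id) (hinv : (Δ + P) ∘ₗ G = LinearMap.id) :
    idef τ₁ τ₁ (Δ' ∘ₗ G') (Δ ∘ₗ G) = -(P' ∘ₗ idef τ₁ τ₂ G' G + idef τ₂ τ₁ P' P ∘ₗ G) := by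
  have e' : Δ' ∘ₗ G' = LinearMap.id - P' ∘ₗ G' := by rw [← hinv', LinearMap.add_comp]; abel
  have e : Δ ∘ₗ G = LinearMap.id - P ∘ₗ G := by rw [← hinv, LinearMap.add_comp]; abel
  rw [e', e, idef_sub, idef_id_id_zero, idef_comp τ₁ τ₂ τ₁, zero_sub]

end Algebra

/-! ## §2 The block-majorant composition: entry 3 from entry 0, the decay of `G`, a bound on `P′`, and the located row `𝔇(P′,P)` -/

section Majorant

variable {g : B6.Geometry} {F₁ F₂ F₁' F₂' : Type} [AddCommGroup F₁] [Module ℝ F₁] [AddCommGroup F₂] [Module ℝ F₂] [AddCommGroup F₁'] [Module ℝ F₁'] [AddCommGroup F₂'] [Module ℝ F₂']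

/-- ★★★ **ENTRY 3 OF (3.42) AT TWO SPACINGS REDUCED TO ENTRY 0** — see the module docstring, §2. [cite: Balaban1985BackgroundPropagators, (3.42) p.397 (the fourth sup entry: shape),
(3.24)–(3.25) p.394; Balaban1984PropagatorsII, (2.52)–(2.56) pp.232–233 (composition of block majorants)] -/
theorem hasMaj_idef_entryThree {b₁ : BlockNorm g F₁} {b₂ : BlockNorm g F₂} {b₁' : BlockNorm g F₁'} {b₂' : BlockNorm g F₂'}
    (τ₁ : F₁ →ₗ[ℝ] F₁') (τ₂ : F₂ →ₗ[ℝ] F₂') {G : F₁ →ₗ[ℝ] F₂} {Δ P : F₂ →ₗ[ℝ] F₁} {G' : F₁' →ₗ[ℝ] F₂'} {Δ' P' : F₂' →ₗ[ℝ] F₁'}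
    (hinv' : (Δ' + P') ∘ₗ G' = LinearMap.id) (hinv : (Δ + P) ∘ₗ G = LinearMap.id)
    (htri : Triangle254 g) (hd : ∀ a b : g.Site, 0 ≤ g.dist a b) {σ c : ℝ} (hrow : RowSum g σ c)
    {aP B ε oP ρ₁ ρ₂ ρ ρ₀ : ℝ} (haP : 0 ≤ aP) (hB : 0 ≤ B) (hε : 0 ≤ ε) (hoP : 0 ≤ oP) (hσ0 : 0 ≤ σ) (hρ₀ : 0 ≤ ρ₀) (hσρ : ρ₀ + σ ≤ ρ) (hσ₁ : ρ₀ + σ ≤ ρ₁) (hσ₂ : ρ₀ + σ ≤ ρ₂)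
    -- the summand on the fine grid, the coarse Green's function, the ENTRY-0 defect, the located summand defect
    (hP' : HasMaj b₂' b₁' P' (fun y y' => aP * Real.exp (-(ρ₁ * g.dist y y'))))
    (hG : HasMaj b₁ b₂ G (fun y y' => B * Real.exp (-(ρ₂ * g.dist y y'))))
    (hDG : HasMaj b₁ b₂' (idef τ₁ τ₂ G' G) (fun y y' => ε * Real.exp (-(ρ * g.dist y y'))))
    (hDP : HasMaj b₂ b₁' (idef τ₂ τ₁ P' P) (fun y y' => oP * Real.exp (-(ρ * g.dist y y')))) :
    HasMaj b₁ b₁' (idef τ₁ τ₁ (Δ' ∘ₗ G') (Δ ∘ₗ G))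
      (fun y y' => (b₂'.κ * aP * ε * c + b₂.κ * oP * B * c) * Real.exp (-(ρ₀ * g.dist y y'))) := by
  rw [idef_entryThree_eq τ₁ τ₂ hinv' hinv]
  -- `P′ ∘ 𝔇(G′,G)`: fine factor at rate `ρ₁`, defect at rate `ρ`
  have h1 := hasMaj_comp_exp (T₁ := P') (T₂ := idef τ₁ τ₂ G' G) htri hd hrow haP hε hρ₀ (by linarith) hσ₁ hP' hDG
  -- `𝔇(P′,P) ∘ G`: defect at rate `ρ`, coarse factor at rate `ρ₂`
  have h2 := hasMaj_comp_exp (T₁ := idef τ₂ τ₁ P' P) (T₂ := G) htri hd hrow hoP hB hρ₀ (by linarith) hσρ hDP hG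
  refine ((h1.add h2).neg).mono fun y y' => le_of_eq ?_
  ring

end Majorant

end Summit.QuantumFields.YangMills.BalabanUVNodes.N15.Gluing

end
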